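import Mathlib
import HarnessLib

/-!
# Route `ResidualThetaTransportAtTwo`, crux Kμ⁺ `SignedMuVanishingAtTwoPlus` (stmt-BirchSwinnertonDyer-20689),
# line `birth`, stub `stub_flatMuZeroAtTwo`: DILATION SUMS on `(ℤ/2ⁿ)^× → 𝔽₂` — Lemma A of the mod-2 transport

Cell `bsd-wall`, width seat `bsd-wall-rtt-p4-w2` (g3). THEOREMS ONLY (no `def`, no named fact, no `sorry`); pure
`Mathlib`; helper `--supports` the crux (used by `…OldClassTransport`, the transport lemma for `T₂`-distributions on the
`2`-power cusps, and `…OldClassFlat`, the old-class descent of FLAT). BSD is not proved by this.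

* §1 `5` modulo `2ⁿ`: `5^{2^j} = 1 + 2^{j+2}·odd`; in `ZMod (2ⁿ)`, `5^{2^{n−2}} = 1`, `5^{2^{n−3}} = 1 + 2^{n−1}`; the unit `5`
  has order `2^{n−2}`, its powers are exactly the kernel of `(ℤ/2ⁿ)^× → (ℤ/4)^×`, so every unit is `± 5^a`
  (`exists_eq_pow_or_eq_neg_pow`).
* §2 Operators: on `V = ((ℤ/2ⁿ)^× → 𝔽₂)` the dilation `D` by `5` satisfies `D^{2^{n−2}} = 1`; for `P ∈ 𝔽₂[X]` with
  `P(D)Φ = 0` and `(X − 1)^{2^{n−3}} ∤ P` one gets `Φ(5^{2^{n−3}} u) = Φ(u)` (`apply_pow_mul_eq_of_aeval_eq_zero`: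
  `P = (X−1)^e Q`, `Q(1) = 1`, `Q(D)^{2^{n−2}} = Q(D^{2^{n−2}}) = 1` by Frobenius, `(X−1)^{2^{n−3}} = X^{2^{n−3}} − 1`);
  `not_dvd_sum_X_pow` — `X^m − 1 ∤ ∑_{t∈S} X^{a_t}` when the `a_t` are distinct mod `m` (map to `𝔽₂[ℤ/m]`).
* §3 `apply_mul_eq_of_sum_dilations_eq_zero` — LEMMA A: if `Φ : (ℤ/2ⁿ)^× → 𝔽₂` is even and `∑_{t∈S} Φ(τ_t u) = 0` for all
  `u`, where the units `τ_t` (`t ∈ S ≠ ∅`) are pairwise `≢ ±` modulo `2^{n−1}`, then `Φ((1 + 2^{n−1}) u) = Φ(u)`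
  (in the local ring `𝔽₂[X]/(X−1)^{2^{n−2}} = 𝔽₂[(ℤ/2ⁿ)^×/±1]` a non-zero element is `(X−1)^e · unit`).

References: M. Emerton, R. Pollack, T. Weston, Invent. Math. 163 (2006) Lemma 4.4.4 [EmertonPollackWeston2006];
B. Mazur, J. Tate, J. Teitelbaum, Invent. Math. 84 (1986) §I.13 (`ℤ₂^× = ±1 × ⟨5⟩`) [MazurTateTeitelbaum1986Invent].
-/


set_option autoImplicit false
set_option linter.dupNamespace false

noncomputable section

open scoped Classical
open Polynomial

namespace Summit.BirchSwinnertonDyer.BirchSwinnertonDyer.Theorems.SignedMuAtTwo.OldClassTransport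

/-! ## §1. The unit `5` modulo `2ⁿ` -/

section Five

/-- `5^{2^j} = 1 + 2^{j+2}·m` with `m` odd (lifting the exponent at `2`). [folklore] -/
theorem exists_five_pow_two_pow_eq (j : ℕ) : ∃ m : ℕ, Odd m ∧ 5 ^ (2 ^ j) = 1 + 2 ^ (j + 2) * m := by
  induction j with
  | zero => exact ⟨1, odd_one, by norm_num⟩
  | succ j ih =>
    obtain ⟨m, hm, h⟩ := ih
    refine ⟨m + 2 ^ (j + 1) * m ^ 2, ?_, ?_⟩
    · apply hm.add_even
      exact (Nat.even_pow.mpr ⟨even_two, by omega⟩).mul_right _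
    · rw [pow_succ, pow_mul, h]; ring

/-- In `ZMod (2ⁿ)`, `n ≥ 2`: `5^{2^{n−2}} = 1`. [folklore] -/
theorem five_pow_two_pow_sub_two {n : ℕ} (hn : 2 ≤ n) : (5 : ZMod (2 ^ n)) ^ (2 ^ (n - 2)) = 1 := by
  obtain ⟨m, -, h⟩ := exists_five_pow_two_pow_eq (n - 2)
  have h1 : (5 : ZMod (2 ^ n)) ^ (2 ^ (n - 2)) = ((5 ^ (2 ^ (n - 2)) : ℕ) : ZMod (2 ^ n)) := by push_cast; rfl
  have h2 : ((2 ^ n : ℕ) : ZMod (2 ^ n)) = 0 := ZMod.natCast_self _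
  rw [h1, h, show n - 2 + 2 = n by omega]
  push_cast
  rw [show (2 : ZMod (2 ^ n)) ^ n = ((2 ^ n : ℕ) : ZMod (2 ^ n)) by push_cast; rfl, h2]
  ring

/-- In `ZMod (2ⁿ)`, `n ≥ 3`: `5^{2^{n−3}} = 1 + 2^{n−1}`. [folklore] -/
theorem five_pow_two_pow_sub_three {n : ℕ} (hn : 3 ≤ n) :
    (5 : ZMod (2 ^ n)) ^ (2 ^ (n - 3)) = 1 + 2 ^ (n - 1) := by
  obtain ⟨m, hm, h⟩ := exists_five_pow_two_pow_eq (n - 3)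
  obtain ⟨r, hr⟩ := hm
  have h1 : (5 : ZMod (2 ^ n)) ^ (2 ^ (n - 3)) = ((5 ^ (2 ^ (n - 3)) : ℕ) : ZMod (2 ^ n)) := by push_cast; rfl
  have h2 : ((2 ^ n : ℕ) : ZMod (2 ^ n)) = 0 := ZMod.natCast_self _
  have h3 : (2 : ZMod (2 ^ n)) ^ (n - 1) * 2 = 0 := by
    rw [← pow_succ, show n - 1 + 1 = n by omega, show (2 : ZMod (2 ^ n)) ^ n = ((2 ^ n : ℕ) : ZMod (2 ^ n)) by
      push_cast; rfl, h2]
  rw [h1, h, hr, show n - 3 + 2 = n - 1 by omega]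
  push_cast
  linear_combination (r : ZMod (2 ^ n)) * h3

/-- `2^{n−1} ≠ 0` in `ZMod (2ⁿ)`. [folklore] -/
theorem two_pow_sub_one_ne_zero (n : ℕ) (hn : 1 ≤ n) : (2 : ZMod (2 ^ n)) ^ (n - 1) ≠ 0 := by
  rw [show (2 : ZMod (2 ^ n)) ^ (n - 1) = ((2 ^ (n - 1) : ℕ) : ZMod (2 ^ n)) by push_cast; rfl, Ne,
    ZMod.natCast_eq_zero_iff]
  intro h
  have h1 : 2 ^ n ≤ 2 ^ (n - 1) := Nat.le_of_dvd (by positivity) h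
  have h2 : 2 ^ (n - 1) < 2 ^ n := Nat.pow_lt_pow_right (by norm_num) (by omega)
  omega

/-- `5` is prime to `2ⁿ`. [folklore] -/
theorem coprime_five_two_pow (n : ℕ) : Nat.Coprime 5 (2 ^ n) :=
  Nat.Coprime.pow_right n (by decide)

/-- `2^{n−1} ∣ 2ⁿ`. [folklore] -/
theorem two_pow_sub_one_dvd (n : ℕ) : 2 ^ (n - 1) ∣ 2 ^ n := pow_dvd_pow 2 (Nat.sub_le n 1)

variable {n : ℕ}

/-- **The unit `5` of `ℤ/2ⁿ` has order `2^{n−2}`** (`n ≥ 3`). [folklore] -/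
theorem orderOf_eq_of_coe_eq_five (hn : 3 ≤ n) (g : (ZMod (2 ^ n))ˣ) (hg : (g : ZMod (2 ^ n)) = 5) :
    orderOf g = 2 ^ (n - 2) := by
  haveI : Fact (Nat.Prime 2) := ⟨Nat.prime_two⟩
  rw [show n - 2 = (n - 3) + 1 by omega]
  apply orderOf_eq_prime_pow
  · intro h
    have h' := congrArg (fun x : (ZMod (2 ^ n))ˣ ↦ (x : ZMod (2 ^ n))) h
    simp only [Units.val_pow_eq_pow_val, hg, Units.val_one, five_pow_two_pow_sub_three hn] at h'
    apply two_pow_sub_one_ne_zero n (by omega)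
    linear_combination h'
  · apply Units.ext
    rw [Units.val_pow_eq_pow_val, hg, show n - 3 + 1 = n - 2 by omega, five_pow_two_pow_sub_two (by omega),
      Units.val_one]

/-- **The powers of `5` are exactly the units `≡ 1 (mod 4)`**: `⟨5⟩ = ker((ℤ/2ⁿ)^× → (ℤ/4)^×)` (both have order
`2^{n−2}`). [folklore] -/
theorem zpowers_eq_ker (hn : 3 ≤ n) (h4 : 4 ∣ 2 ^ n) (g : (ZMod (2 ^ n))ˣ) (hg : (g : ZMod (2 ^ n)) = 5) :
    Subgroup.zpowers g = (ZMod.unitsMap h4).ker := by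
  haveI : NeZero (2 ^ n) := ⟨pow_ne_zero n two_ne_zero⟩
  apply Subgroup.eq_of_le_of_card_ge
  · rw [Subgroup.zpowers_le, MonoidHom.mem_ker]
    apply Units.ext
    rw [ZMod.unitsMap_def, Units.coe_map, Units.val_one, MonoidHom.coe_coe, hg, map_ofNat]
    decide
  · rw [Nat.card_zpowers, orderOf_eq_of_coe_eq_five hn g hg]
    have h1 := Subgroup.card_mul_index (ZMod.unitsMap h4).ker
    rw [Subgroup.index_ker, MonoidHom.range_eq_top.mpr (ZMod.unitsMap_surjective _), Subgroup.card_top] at h1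
    have hG : Nat.card (ZMod (2 ^ n))ˣ = 2 ^ (n - 1) := by
      rw [Nat.card_eq_fintype_card, ZMod.card_units_eq_totient, Nat.totient_prime_pow Nat.prime_two (by omega)]
      simp
    have h4 : Nat.card (ZMod 4)ˣ = 2 := by
      rw [Nat.card_eq_fintype_card, ZMod.card_units_eq_totient]; decide
    rw [hG, h4, show 2 ^ (n - 1) = 2 ^ (n - 2) * 2 by rw [← pow_succ]; congr 1; omega] at h1
    have := Nat.eq_of_mul_eq_mul_right two_pos h1
    omega

/-- **Every unit of `ℤ/2ⁿ` is `± 5^a`** (`n ≥ 3`). [folklore] -/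
theorem exists_eq_pow_or_eq_neg_pow (hn : 3 ≤ n) (g : (ZMod (2 ^ n))ˣ) (hg : (g : ZMod (2 ^ n)) = 5)
    (u : (ZMod (2 ^ n))ˣ) : ∃ a : ℕ, u = g ^ a ∨ u = -(g ^ a) := by
  haveI : NeZero (2 ^ n) := ⟨pow_ne_zero n two_ne_zero⟩
  have h4 : 4 ∣ 2 ^ n := by rw [show (4 : ℕ) = 2 ^ 2 by norm_num]; exact pow_dvd_pow 2 (by omega)
  have key : ∀ v : (ZMod (2 ^ n))ˣ, ZMod.unitsMap h4 v = 1 → ∃ a : ℕ, v = g ^ a := by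
    intro v hv
    have hmem : v ∈ Subgroup.zpowers g := by rw [zpowers_eq_ker hn h4 g hg]; exact hv
    rw [← mem_powers_iff_mem_zpowers] at hmem
    obtain ⟨a, ha⟩ := hmem
    exact ⟨a, ha.symm⟩
  have hdich : ∀ x : (ZMod 4)ˣ, x = 1 ∨ x = -1 := by decide
  rcases hdich (ZMod.unitsMap h4 u) with h | h
  · obtain ⟨a, ha⟩ := key u h
    exact ⟨a, Or.inl ha⟩
  · obtain ⟨a, ha⟩ := key (-u) (by
      apply Units.ext
      have h' := congrArg (fun x : (ZMod 4)ˣ ↦ (x : ZMod 4)) h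
      simp only [ZMod.unitsMap_def, Units.coe_map, MonoidHom.coe_coe, Units.val_neg, Units.val_one] at h' ⊢
      rw [map_neg, h', neg_neg])
    exact ⟨a, Or.inr (by rw [← ha, neg_neg])⟩

end Five

/-! ## §2. Dilation operators on `(ℤ/2ⁿ)^× → 𝔽₂` and polynomials over `𝔽₂` -/

section Operators

variable {n : ℕ}

/-- `(D_g^a Φ)(u) = Φ(g^a u)` for the dilation operator `D_g Φ = Φ(g ·)`. [folklore] -/
theorem funLeft_pow_apply (g : (ZMod (2 ^ n))ˣ) (a : ℕ) (Φ : (ZMod (2 ^ n))ˣ → ZMod 2) (u : (ZMod (2 ^ n))ˣ) :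
    ((LinearMap.funLeft (ZMod 2) (ZMod 2) (fun v : (ZMod (2 ^ n))ˣ ↦ g * v)) ^ a) Φ u = Φ (g ^ a * u) := by
  rw [Module.End.pow_apply]
  induction a generalizing u with
  | zero => simp
  | succ a ih =>
    rw [Function.iterate_succ_apply', LinearMap.funLeft_apply, ih, pow_succ, mul_assoc]

/-- `(P(D_g) Φ)(u) = ∑_{t∈S} Φ(g^{a_t} u)` for `P = ∑_{t∈S} X^{a_t}`. [folklore] -/
theorem aeval_sum_X_pow_apply (g : (ZMod (2 ^ n))ˣ) (S : Finset ℕ) (a : ℕ → ℕ)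
    (Φ : (ZMod (2 ^ n))ˣ → ZMod 2) (u : (ZMod (2 ^ n))ˣ) :
    (Polynomial.aeval (LinearMap.funLeft (ZMod 2) (ZMod 2) (fun v : (ZMod (2 ^ n))ˣ ↦ g * v))
      (∑ t ∈ S, (X : (ZMod 2)[X]) ^ (a t))) Φ u = ∑ t ∈ S, Φ (g ^ (a t) * u) := by
  rw [map_sum, LinearMap.sum_apply, Finset.sum_apply]
  refine Finset.sum_congr rfl fun t _ ↦ ?_
  rw [Polynomial.aeval_X_pow, funLeft_pow_apply]

/-- Over `𝔽₂`: `expand 2^k Q = Q^{2^k}` (Frobenius). [folklore] -/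
theorem expand_two_pow_eq_pow (Q : (ZMod 2)[X]) (k : ℕ) : Polynomial.expand (ZMod 2) (2 ^ k) Q = Q ^ (2 ^ k) := by
  haveI : Fact (Nat.Prime 2) := ⟨Nat.prime_two⟩
  induction k with
  | zero => simp
  | succ k ih => rw [pow_succ, Polynomial.expand_mul, ZMod.expand_card, map_pow, ih, ← pow_mul]

/-- Over `𝔽₂`: `(X − 1)^{2^k} = X^{2^k} − 1`. [folklore] -/
theorem X_sub_one_pow_two_pow (k : ℕ) : ((X : (ZMod 2)[X]) - C 1) ^ (2 ^ k) = X ^ (2 ^ k) - 1 := by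
  haveI : Fact (Nat.Prime 2) := ⟨Nat.prime_two⟩
  rw [map_one, sub_pow_char_pow, one_pow]

/-- **Annihilation by `P(D)` with `(X−1)^{2^{n−3}} ∤ P` forces invariance under `5^{2^{n−3}}`.** Let `g = 5` in
`(ℤ/2ⁿ)^×` (`n ≥ 3`), `D = D_g`; if `P(D)Φ = 0` with `P ≠ 0`, `(X−1)^{2^{n−3}} ∤ P`, then `Φ(g^{2^{n−3}} u) = Φ(u)`:
`P = (X−1)^e Q` with `e < 2^{n−3}`, `Q(1) = 1`; `Q(D)^{2^{n−2}} = Q(D^{2^{n−2}}) = Q(1) = 1` (Frobenius, `D^{2^{n−2}} = 1`);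
so `(X−1)^{2^{n−3}−e} Q^{2^{n−2}−1} · P = (X^{2^{n−3}} − 1) Q^{2^{n−2}}` kills `Φ`, i.e. `(D^{2^{n−3}} − 1)Φ = 0`. [folklore] -/
theorem apply_pow_mul_eq_of_aeval_eq_zero (hn : 3 ≤ n) (g : (ZMod (2 ^ n))ˣ) (hg : (g : ZMod (2 ^ n)) = 5)
    {P : (ZMod 2)[X]} (hP : P ≠ 0) (hroot : ¬ ((X : (ZMod 2)[X]) - C 1) ^ (2 ^ (n - 3)) ∣ P)
    (Φ : (ZMod (2 ^ n))ˣ → ZMod 2)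
    (hΦ : Polynomial.aeval (LinearMap.funLeft (ZMod 2) (ZMod 2) (fun v : (ZMod (2 ^ n))ˣ ↦ g * v)) P Φ = 0)
    (u : (ZMod (2 ^ n))ˣ) : Φ (g ^ (2 ^ (n - 3)) * u) = Φ u := by
  set D : Module.End (ZMod 2) ((ZMod (2 ^ n))ˣ → ZMod 2) :=
    LinearMap.funLeft (ZMod 2) (ZMod 2) (fun v : (ZMod (2 ^ n))ˣ ↦ g * v) with hD
  set m : ℕ := 2 ^ (n - 3) with hm
  have hm1 : 1 ≤ m := Nat.one_le_two_pow
  -- `P = (X - 1)^e Q`, `e ≤ m - 1`, `Q(1) = 1`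
  have he : P.rootMultiplicity 1 ≤ m - 1 :=
    (Polynomial.rootMultiplicity_le_iff hP 1 (m - 1)).mpr (by rwa [Nat.sub_add_cancel hm1])
  obtain ⟨Q, hPQ, hQ⟩ := Polynomial.exists_eq_pow_rootMultiplicity_mul_and_not_dvd P hP 1
  set e : ℕ := P.rootMultiplicity 1 with he_def
  have hQ1 : Q.eval 1 = 1 := by
    rw [Polynomial.dvd_iff_isRoot, Polynomial.IsRoot.def] at hQ
    have : ∀ x : ZMod 2, x ≠ 0 → x = 1 := by decide
    exact this _ hQ
  -- `D^{2^{n-2}} = 1`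
  have hDpow : D ^ (2 ^ (n - 2)) = 1 := by
    apply LinearMap.ext
    intro Ψ
    funext v
    rw [hD, funLeft_pow_apply, ← orderOf_eq_of_coe_eq_five hn g hg, pow_orderOf_eq_one, one_mul,
      Module.End.one_apply]
  -- `Q(D)^{2^{n-2}} = 1`
  have hQpow : (Polynomial.aeval D Q) ^ (2 ^ (n - 2)) = 1 := by
    rw [← map_pow, ← expand_two_pow_eq_pow, Polynomial.expand_aeval, hDpow,
      show (1 : Module.End (ZMod 2) ((ZMod (2 ^ n))ˣ → ZMod 2)) = algebraMap (ZMod 2) _ 1 from (map_one _).symm,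
      Polynomial.aeval_algebraMap_apply_eq_algebraMap_eval, hQ1, map_one]
  -- the polynomial identity
  have hRP : ((X - C 1) ^ (m - e) * Q ^ (2 ^ (n - 2) - 1)) * P = (X ^ m - 1) * Q ^ (2 ^ (n - 2)) := by
    have h2 : 1 ≤ 2 ^ (n - 2) := Nat.one_le_two_pow
    have h3 : ((X - C 1) ^ (m - e) * Q ^ (2 ^ (n - 2) - 1)) * P =
        ((X - C 1) ^ (m - e) * (X - C 1) ^ e) * (Q ^ (2 ^ (n - 2) - 1) * Q) := by
      conv_lhs => rw [hPQ]
      ring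
    calc ((X - C 1) ^ (m - e) * Q ^ (2 ^ (n - 2) - 1)) * P
        = ((X - C 1) ^ (m - e) * (X - C 1) ^ e) * (Q ^ (2 ^ (n - 2) - 1) * Q) := h3
      _ = (X - C 1) ^ m * Q ^ (2 ^ (n - 2)) := by
          rw [← pow_add, Nat.sub_add_cancel (he.trans (Nat.sub_le m 1)), ← pow_succ, Nat.sub_add_cancel h2]
      _ = (X ^ m - 1) * Q ^ (2 ^ (n - 2)) := by rw [hm, X_sub_one_pow_two_pow]
  -- apply `aeval D` and evaluate at `Φ`
  have h1 := congrArg (fun T : (ZMod 2)[X] ↦ Polynomial.aeval D T Φ) hRP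
  simp only [map_mul, Module.End.mul_apply, hΦ, map_zero, map_sub, map_pow, map_one, Polynomial.aeval_X,
    hQpow, Module.End.one_apply] at h1
  have h2 := congrFun h1 u
  rw [Pi.zero_apply, LinearMap.sub_apply, Pi.sub_apply, hD, funLeft_pow_apply, Module.End.one_apply] at h2
  have h3 : ∀ x y : ZMod 2, 0 = x - y → x = y := by decide
  exact h3 _ _ h2

/-- **`X^m − 1 ∤ ∑_{t∈S} X^{a_t}` over `𝔽₂` when the exponents `a_t` are distinct modulo `m`** (map to the group
algebra `𝔽₂[ℤ/m]`, where `X^m − 1 ↦ 0` and the sum maps to a sum of distinct basis vectors). [folklore] -/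
theorem not_dvd_sum_X_pow {m : ℕ} [NeZero m] (S : Finset ℕ) (a : ℕ → ℕ) {t₀ : ℕ} (ht₀ : t₀ ∈ S)
    (hdist : ∀ t ∈ S, ∀ t' ∈ S, (a t : ZMod m) = (a t' : ZMod m) → t = t') :
    ¬ ((X : (ZMod 2)[X]) ^ m - 1) ∣ ∑ t ∈ S, (X : (ZMod 2)[X]) ^ (a t) := by
  rintro ⟨G, hG⟩
  let φ : (ZMod 2)[X] →+* AddMonoidAlgebra (ZMod 2) (ZMod m) :=
    (AddMonoidAlgebra.mapDomainRingHom (ZMod 2) (Nat.castAddMonoidHom (ZMod m))).comp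
      (Polynomial.toFinsuppIso (ZMod 2)).toRingHom
  have hφX : ∀ k : ℕ, φ (X ^ k) = AddMonoidAlgebra.single (k : ZMod m) (1 : ZMod 2) := by
    intro k
    simp only [φ, RingHom.coe_comp, Function.comp_apply, RingEquiv.toRingHom_eq_coe, RingEquiv.coe_toRingHom,
      Polynomial.toFinsuppIso_apply, Polynomial.toFinsupp_X_pow, AddMonoidAlgebra.mapDomainRingHom_apply,
      AddMonoidAlgebra.mapDomain_single]
    rfl
  have hφ0 : φ (X ^ m - 1) = 0 := by
    rw [map_sub, map_one, hφX, ZMod.natCast_self, AddMonoidAlgebra.one_def, sub_self]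
  have hsum : φ (∑ t ∈ S, (X : (ZMod 2)[X]) ^ (a t)) = ∑ t ∈ S, φ (X ^ (a t)) := map_sum φ _ S
  have h := congrArg φ hG
  rw [map_mul, hφ0, zero_mul, hsum] at h
  simp only [hφX] at h
  have h2 := congrArg (fun x : AddMonoidAlgebra (ZMod 2) (ZMod m) ↦ x.coeff (a t₀ : ZMod m)) h
  simp only [AddMonoidAlgebra.coeff_sum, AddMonoidAlgebra.coeff_single, AddMonoidAlgebra.coeff_zero,
    Finsupp.coe_finsetSum, Finset.sum_apply, Finsupp.single_apply, Finsupp.coe_zero, Pi.zero_apply] at h2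
  rw [Finset.sum_eq_single t₀ (fun t ht hne ↦ if_neg fun h' ↦ hne (hdist t ht t₀ ht₀ h')) (fun h' ↦ absurd ht₀ h'),
    if_pos rfl] at h2
  exact one_ne_zero h2

end Operators

/-! ## §3. Lemma A: vanishing dilation sums force invariance under `1 + 2^{n−1}` -/

section LemmaA

variable {n : ℕ}

/-- **LEMMA A.** Let `n ≥ 3`, `Φ : (ℤ/2ⁿ)^× → 𝔽₂` EVEN (`Φ(−u) = Φ(u)`), `S` a non-empty finite set, `τ : S → (ℤ/2ⁿ)^×`
with the `τ_t` pairwise `≢ ± τ_{t'} (mod 2^{n−1})`, and suppose `∑_{t∈S} Φ(τ_t u) = 0` for every `u`. Then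
`Φ((1 + 2^{n−1}) u) = Φ(u)` for every `u`. Proof: `τ_t = ± 5^{a_t}` (§1); `P = ∑ X^{a_t}` has `P(D_5)Φ = 0` (evenness)
and the `a_t` are distinct mod `2^{n−3}` (else `τ_t ≡ ± τ_{t'} (mod 2^{n−1})`), so `X^{2^{n−3}} − 1 = (X−1)^{2^{n−3}} ∤ P`
(§2) and §2 gives invariance under `5^{2^{n−3}} = 1 + 2^{n−1}`. [folklore] -/
theorem apply_mul_eq_of_sum_dilations_eq_zero (hn : 3 ≤ n) (S : Finset ℕ) (hS : S.Nonempty)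
    (τ : ℕ → (ZMod (2 ^ n))ˣ)
    (hdist : ∀ t ∈ S, ∀ t' ∈ S, t ≠ t' →
      ZMod.castHom (two_pow_sub_one_dvd n) (ZMod (2 ^ (n - 1))) (τ t : ZMod (2 ^ n)) ≠
        ZMod.castHom (two_pow_sub_one_dvd n) (ZMod (2 ^ (n - 1))) (τ t' : ZMod (2 ^ n)) ∧
      ZMod.castHom (two_pow_sub_one_dvd n) (ZMod (2 ^ (n - 1))) (τ t : ZMod (2 ^ n)) ≠
        - ZMod.castHom (two_pow_sub_one_dvd n) (ZMod (2 ^ (n - 1))) (τ t' : ZMod (2 ^ n)))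
    (Φ : (ZMod (2 ^ n))ˣ → ZMod 2) (heven : ∀ u, Φ (-u) = Φ u)
    (hkill : ∀ u, ∑ t ∈ S, Φ (τ t * u) = 0)
    (w : (ZMod (2 ^ n))ˣ) (hw : (w : ZMod (2 ^ n)) = 1 + 2 ^ (n - 1)) :
    ∀ u, Φ (w * u) = Φ u := by
  haveI : NeZero (2 ^ n) := ⟨pow_ne_zero n two_ne_zero⟩
  haveI : NeZero (2 ^ (n - 3)) := ⟨pow_ne_zero _ two_ne_zero⟩
  set g : (ZMod (2 ^ n))ˣ := ZMod.unitOfCoprime 5 (coprime_five_two_pow n) with hgdef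
  have hg : (g : ZMod (2 ^ n)) = 5 := by rw [hgdef, ZMod.coe_unitOfCoprime]; push_cast; rfl
  have hgw : g ^ (2 ^ (n - 3)) = w := by
    apply Units.ext
    rw [Units.val_pow_eq_pow_val, hg, five_pow_two_pow_sub_three hn, hw]
  -- discrete logarithms
  choose a ha using fun t ↦ exists_eq_pow_or_eq_neg_pow hn g hg (τ t)
  set m : ℕ := 2 ^ (n - 3) with hm
  set P : (ZMod 2)[X] := ∑ t ∈ S, (X : (ZMod 2)[X]) ^ (a t) with hP
  -- `P(D)Φ = 0`
  have hPΦ : Polynomial.aeval (LinearMap.funLeft (ZMod 2) (ZMod 2) (fun v : (ZMod (2 ^ n))ˣ ↦ g * v)) P Φ = 0 := by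
    funext u
    rw [hP, aeval_sum_X_pow_apply, Pi.zero_apply, ← hkill u]
    refine Finset.sum_congr rfl fun t _ ↦ ?_
    rcases ha t with h | h
    · rw [← h]
    · rw [show g ^ (a t) = -τ t by rw [h, neg_neg], neg_mul, heven]
  -- the casts to `ZMod (2^(n-1))` kill `w`
  set π : ZMod (2 ^ n) →+* ZMod (2 ^ (n - 1)) := ZMod.castHom (two_pow_sub_one_dvd n) (ZMod (2 ^ (n - 1)))
    with hπ
  have hπw : π (w : ZMod (2 ^ n)) = 1 := by
    rw [hw, map_add, map_one, map_pow, map_ofNat,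
      show (2 : ZMod (2 ^ (n - 1))) ^ (n - 1) = ((2 ^ (n - 1) : ℕ) : ZMod (2 ^ (n - 1))) by push_cast; rfl,
      ZMod.natCast_self, add_zero]
  have hπgm : ∀ q : ℕ, π ((g : ZMod (2 ^ n)) ^ (m * q)) = 1 := by
    intro q
    rw [pow_mul, ← Units.val_pow_eq_pow_val, hm, hgw, map_pow, hπw, one_pow]
  -- distinctness of the exponents modulo `m`
  have hadist : ∀ t ∈ S, ∀ t' ∈ S, (a t : ZMod m) = (a t' : ZMod m) → t = t' := by
    intro t ht t' ht' hmod
    by_contra hne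
    -- WLOG via symmetric statement: from `a t ≡ a t' (mod m)` get `π (g^{a t}) = π (g^{a t'})`
    have hπeq : π ((g : ZMod (2 ^ n)) ^ (a t)) = π ((g : ZMod (2 ^ n)) ^ (a t')) := by
      rw [ZMod.natCast_eq_natCast_iff'] at hmod
      rw [← Nat.div_add_mod (a t) m, ← Nat.div_add_mod (a t') m, hmod, pow_add, pow_add, map_mul, map_mul,
        hπgm, hπgm]
    have hτ : ∀ s, π (τ s : ZMod (2 ^ n)) = π ((g : ZMod (2 ^ n)) ^ (a s)) ∨
        π (τ s : ZMod (2 ^ n)) = - π ((g : ZMod (2 ^ n)) ^ (a s)) := by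
      intro s
      rcases ha s with h | h
      · left; rw [h, Units.val_pow_eq_pow_val]
      · right; rw [h, Units.val_neg, Units.val_pow_eq_pow_val, map_neg]
    obtain ⟨h1, h2⟩ := hdist t ht t' ht' hne
    rcases hτ t with ht1 | ht1 <;> rcases hτ t' with ht2 | ht2
    · exact h1 (by rw [ht1, ht2, hπeq])
    · exact h2 (by rw [ht1, ht2, hπeq, neg_neg])
    · exact h2 (by rw [ht1, ht2, hπeq])
    · exact h1 (by rw [ht1, ht2, hπeq])
  -- `(X - 1)^m ∤ P`, `P ≠ 0`
  obtain ⟨t₀, ht₀⟩ := hS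
  have hroot : ¬ ((X : (ZMod 2)[X]) - C 1) ^ (2 ^ (n - 3)) ∣ P := by
    rw [X_sub_one_pow_two_pow, ← hm, hP]
    exact not_dvd_sum_X_pow S a ht₀ hadist
  have hP0 : P ≠ 0 := by
    rintro h0; rw [h0] at hroot; exact hroot (dvd_zero _)
  intro u
  rw [← hgw]
  exact apply_pow_mul_eq_of_aeval_eq_zero hn g hg hP0 hroot Φ hPΦ u

end LemmaA

end Summit.BirchSwinnertonDyer.BirchSwinnertonDyer.Theorems.SignedMuAtTwo.OldClassTransport

end
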